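import Summits.BirchSwinnertonDyer.BirchSwinnertonDyer.Theorems.PoitouTateSelmerStructureDualityConjHolds
import Literature.NumberTheory.GaloisCohomology.LocalInvariantMapConjCompatible
import HarnessLib

/-!
# stub_poitouTateSelmer — Poitou–Tate duality for Selmer structures (cite stub for birth.lean)

Landing the cite stub `stub_poitouTateSelmer` for crux item stmt-BirchSwinnertonDyer-21422
(`WildJetchevBoundAtPTwoSplit`). The stub states Poitou–Tate duality for Selmer structures
(Milne ADT I.4.10) for every number field K.

This is already proved in the tree as
`InputsPoitouTateSelmer.poitouTate_selmerStructure_duality_conj_holds K`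
in `Theorems/PoitouTateSelmerStructureDualityConjHolds.lean` (p-ID from bsd-inputs-honda-p1).

References: [MilneADT2006, Ch. I, Thm. 4.10(b)]; [Howard2004HeegnerKolyvagin, Thm. 2.1.11].
BSD is NOT proved by this.
-/

set_option linter.dupNamespace false
set_option autoImplicit false

namespace Summit.BirchSwinnertonDyer.BirchSwinnertonDyer.Theorems.BirthPoitouTateSelmer

open Literature.NumberTheory.GaloisCohomology

/-- **Poitou–Tate duality for Selmer structures** at every number field K (cite stub for
WildJetchevBoundAtPTwoSplit birth.lean). Follows immediately from the tree theorem
`InputsPoitouTateSelmer.poitouTate_selmerStructure_duality_conj_holds`.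
[cite: MilneADT2006, Ch. I, Thm. 4.10(b)] -/
theorem stub_poitouTateSelmer :
    ∀ (K : Type) [Field K] [NumberField K], poitouTate_selmerStructure_duality_conj K :=
  fun K _ _ => InputsPoitouTateSelmer.poitouTate_selmerStructure_duality_conj_holds K

end Summit.BirchSwinnertonDyer.BirchSwinnertonDyer.Theorems.BirthPoitouTateSelmer
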